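import Summits.CriticalPhenomena.PercolationContinuityZ3.Theorems.Transplant.FKConnectivityAllQPat3ShapeThree
import Summits.CriticalPhenomena.PercolationContinuityZ3.Theorems.Transplant.FKConnectivityAllQPat3ShapeTwoCells
import Summits.CriticalPhenomena.PercolationContinuityZ3.Theorems.Transplant.FKConnectivityAllQPat3FastCheck
import HarnessLib

/-!
# Connectivity correlation inequalities for `φ_{w,q}`, every `q > 0` — THREE-PIECE SHAPES: index products and the TABULATED +
# SUPPORT-FILTERED certificate check (side table → sparse coefficient table → census g36's `FK.loop1G` pair loops; census g40)

Definitions + theorems file (`--supports stmt-CriticalPhenomena-4575`), census lineage (gen 40) of LANE 2's FK sub-programme; builds on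
p205010 (kernel theorem, internal audit signed; external expert review pending).  No named facts, no sorries; standard axioms.

* `FK.certCheck3S` (+ `_spec`) — the direct check (small shapes only; re-folds the skeleton in every row);
* `FK.Prod3.ofIdx fam (λ, shift, i_K, i₁, i₂)` and `FK.Prod3.ofIdx_nonneg` (pool = `FK.famP11orb` of `…Pat3ShapeTwoTab.lean`);
* `FK.side3R`, `FK.sideGet3` (`[mask][PK][P1][P2]`), **`FK.sideCheck3`** (+ `_spec`), `FK.coefSide3`, `FK.coefTab3_eq_coefSide3`,
  `FK.coefGet3` (`[d][PK][QK][P1][Q1][P2][Q2]`, SPARSE: missing tails read `0`), `FK.coefRows3` (one level), **`FK.coefCheck3`**,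
  `FK.coefCheck3_of_levels` (one kernel computation per level), `FK.coefCheck3_spec`, `FK.coefGet3_eq_zero`;
* CELL-WISE verification on `FK.foldVec` (`…Pat3ShapeTwoCells.lean`): `FK.cellTerms3`, `FK.cellLit3`, `FK.cellOK3` (+ `_spec`),
  **`FK.coefCells3`** (unit = first pattern `PK`) / **`FK.coefCellsPQ3`** (unit = first pair, for skeletons with many colourings),
  `FK.coefCheck3_of_cells` / `FK.coefCheck3_of_cellsPQ`;
* **`FK.rows_of_tab3`** — side check + coefficient check up to `B + 6` (literal of length `≤ B + 6`) + shift bound + the 25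
  first-pair loops `FK.loop1G (symm8d (coefGet3 T)) 8 Dn B (prods.filter …) PK QK = true` of census g36's support-filtered fast check
  (`…Pat3FastCheck.lean`, generic target, here the SYMMETRISED tabulated coefficient lookup) ⇒ the rowwise domination
  `8·Σ λ·tensor ≤ Dn·symm8d (coefTab3 …)` consumed by `FK.shape3C_nonneg_of_rows`.
MEASURED (census g40, EEE-triangle × T_sym, 500 products, 3 plain edges): side check + one coefficient level + two pair loops in
< 60 s of kernel time; the direct `FK.certCheck3S` is infeasible at this size (re-folds the skeleton in each of `25³·2·(B+6)` rows).
[cite: AyyerLinussonRavichandran2025, §7 (p. 22)]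
-/

namespace Summit.CriticalPhenomena.PercolationContinuityZ3.Theorems

namespace FK

open SimpleGraph Literature.Probability.LatticeModels Literature.Probability.Percolation
open scoped Classical

variable {V : Type*}

/-! ### Tabulated + support-filtered certificate checking for three-piece shapes (side table → coefficient table →
census g36's `FK.certCheckGF` loops with the symmetrised coefficient lookup as target) -/

section TabThree

variable {ι : Type*} [DecidableEq ι]

/-- **THE CERTIFICATE CHECK of a three-piece shape** (census g36's `FK.certCheck3` with the skeleton inside the target and the
target symmetrised over the eight flips, as in `FK.cone3_level_nonneg_sym`): shifts `≤ B`, and at every residual level `d < B + 6`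
and every pattern-pair triple `8 · Σ λ · tensor ≤ Dn · symm8d coef`.  A `Bool` for `decide`. [folklore] -/
def certCheck3S (coef : ℕ → Pat3 → Pat3 → Pat3 → Pat3 → Pat3 → Pat3 → ℤ) (prods : List Prod3) (Dn B : ℕ) : Bool :=
  (prods.all fun q => decide (q.shift ≤ B)) &&
    (List.range (B + 6)).all fun d => Pat3.list.all fun PK => Pat3.list.all fun QK => Pat3.list.all fun P1 =>
      Pat3.list.all fun Q1 => Pat3.list.all fun P2 => Pat3.list.all fun Q2 =>
        decide (8 * (prods.map fun q => (q.lam : ℤ) * q.tensor d PK QK P1 Q1 P2 Q2).sum ≤ (Dn : ℤ) * symm8d coef d PK QK P1 Q1 P2 Q2)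

/-- Unpacking a passed three-piece certificate check (all levels, using the structural vanishing above `B + 6`). [folklore] -/
theorem certCheck3S_spec {L : List (ι × ι)} {iK jK kK i1 j1 k1 i2 j2 k2 ix iy is : ι} {F : ℕ → Pat3 → Pat3 → ℤ}
    {prods : List Prod3} {Dn B : ℕ} (hB : 2 * L.length + 2 ≤ B)
    (h : certCheck3S (coefTab3 L iK jK kK i1 j1 k1 i2 j2 k2 ix iy is F) prods Dn B = true) (d : ℕ)
    (PK QK P1 Q1 P2 Q2 : Pat3) :
    8 * (prods.map fun q => (q.lam : ℤ) * q.tensor d PK QK P1 Q1 P2 Q2).sum ≤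
      (Dn : ℤ) * symm8d (coefTab3 L iK jK kK i1 j1 k1 i2 j2 k2 ix iy is F) d PK QK P1 Q1 P2 Q2 := by
  unfold certCheck3S at h
  rw [Bool.and_eq_true] at h
  obtain ⟨hshift, hmain⟩ := h
  simp only [List.all_eq_true, decide_eq_true_eq] at hshift hmain
  by_cases hd : d < B + 6
  · exact hmain d (List.mem_range.2 hd) PK PK.mem_list QK QK.mem_list P1 P1.mem_list Q1 Q1.mem_list P2 P2.mem_list Q2 Q2.mem_list
  · rw [not_lt] at hd
    have hz : ∀ A1 A2 A3 A4 A5 A6 : Pat3, coefTab3 L iK jK kK i1 j1 k1 i2 j2 k2 ix iy is F d A1 A2 A3 A4 A5 A6 = 0 :=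
      fun _ _ _ _ _ _ => coefTab3_eq_zero L iK jK kK i1 j1 k1 i2 j2 k2 ix iy is F (by omega) _ _ _ _ _ _
    simp only [symm8d, hz, add_zero, mul_zero]
    refine le_of_eq ?_
    rw [List.sum_eq_zero fun x hx => ?_, mul_zero]
    rw [List.mem_map] at hx
    obtain ⟨q, hq, rfl⟩ := hx
    rw [Prod3.tensor_eq_zero_of_le q (hshift q hq) hd, mul_zero]

/-- A three-piece product given by family indices `(λ, shift, i_K, i₁, i₂)`. [folklore] -/
def Prod3.ofIdx (fam : List (ℕ → Pat3 → Pat3 → ℤ)) (c : ℕ × ℕ × ℕ × ℕ × ℕ) : Prod3 :=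
  ⟨c.1, c.2.1, famGet fam c.2.2.1, famGet fam c.2.2.2.1, famGet fam c.2.2.2.2⟩

omit [DecidableEq ι] in
/-- Index-given products inherit levelwise nonnegativity from the family on each piece. [folklore] -/
theorem Prod3.ofIdx_nonneg {V : Type*} {fam : List (ℕ → Pat3 → Pat3 → ℤ)} {cs : List (ℕ × ℕ × ℕ × ℕ × ℕ)}
    {EK CK E₁ C₁ E₂ C₂ : Finset (Sym2 V)} {uK vK mK u₁ v₁ m₁ u₂ v₂ m₂ : V}
    (hK : ∀ i ν, 0 ≤ lev2C EK CK uK vK mK (famGet fam i) ν) (h1 : ∀ i ν, 0 ≤ lev2C E₁ C₁ u₁ v₁ m₁ (famGet fam i) ν)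
    (h2 : ∀ i ν, 0 ≤ lev2C E₂ C₂ u₂ v₂ m₂ (famGet fam i) ν) :
    ∀ q ∈ cs.map (Prod3.ofIdx fam), ∀ ν : ℕ,
      0 ≤ lev2C EK CK uK vK mK q.gK ν ∧ 0 ≤ lev2C E₁ C₁ u₁ v₁ m₁ q.g1 ν ∧ 0 ≤ lev2C E₂ C₂ u₂ v₂ m₂ q.g2 ν := by
  intro q hq ν
  rw [List.mem_map] at hq
  obtain ⟨c, _, rfl⟩ := hq
  exact ⟨hK _ ν, h1 _ ν, h2 _ ν⟩

/-- The reading of one side of a three-piece shape: (pattern at the marks, level corrections). [folklore] -/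
def side3R (L : List (ι × ι)) (iK jK kK i1 j1 k1 i2 j2 k2 ix iy is : ι) (bs : List Bool) (PK P1 P2 : Pat3) : Pat3 × ℕ :=
  (rdPat ix iy is (side3 L iK jK kK i1 j1 k1 i2 j2 k2 bs PK P1 P2).1, (side3 L iK jK kK i1 j1 k1 i2 j2 k2 bs PK P1 P2).2)

/-- Lookup in a three-piece side table `[mask][PK][P1][P2]`. [folklore] -/
def sideGet3 (S : List (List (List (List (Pat3 × ℕ))))) (bs : List Bool) (PK P1 P2 : Pat3) : Pat3 × ℕ :=
  (((S.getD (maskOf bs) []).getD PK.ix []).getD P1.ix []).getD P2.ix (Pat3.all, 0)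

/-- **Side-table check** (three pieces). [folklore] -/
def sideCheck3 (L : List (ι × ι)) (iK jK kK i1 j1 k1 i2 j2 k2 ix iy is : ι) (S : List (List (List (List (Pat3 × ℕ))))) : Bool :=
  (allBits L.length).all fun bs => Pat3.list.all fun PK => Pat3.list.all fun P1 => Pat3.list.all fun P2 =>
    decide (sideGet3 S bs PK P1 P2 = side3R L iK jK kK i1 j1 k1 i2 j2 k2 ix iy is bs PK P1 P2)

/-- Unpacking a passed three-piece side-table check. [folklore] -/
theorem sideCheck3_spec {L : List (ι × ι)} {iK jK kK i1 j1 k1 i2 j2 k2 ix iy is : ι} {S : List (List (List (List (Pat3 × ℕ))))}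
    (h : sideCheck3 L iK jK kK i1 j1 k1 i2 j2 k2 ix iy is S = true) {bs : List Bool} (hbs : bs.length = L.length)
    (PK P1 P2 : Pat3) : sideGet3 S bs PK P1 P2 = side3R L iK jK kK i1 j1 k1 i2 j2 k2 ix iy is bs PK P1 P2 := by
  unfold sideCheck3 at h
  simp only [List.all_eq_true, decide_eq_true_eq] at h
  exact h bs (mem_allBits.2 hbs) PK PK.mem_list P1 P1.mem_list P2 P2.mem_list

/-- The three-piece coefficient table computed from a side table. [folklore] -/
def coefSide3 (n : ℕ) (S : List (List (List (List (Pat3 × ℕ))))) (F : ℕ → Pat3 → Pat3 → ℤ) (d : ℕ) (PK QK P1 Q1 P2 Q2 : Pat3) :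
    ℤ :=
  sumBits n fun bs =>
    (if (sideGet3 S bs PK P1 P2).2 + (sideGet3 S (bs.map (! ·)) QK Q1 Q2).2 = d then
        F 0 (sideGet3 S bs PK P1 P2).1 (sideGet3 S (bs.map (! ·)) QK Q1 Q2).1 else 0) +
      (if (sideGet3 S bs PK P1 P2).2 + (sideGet3 S (bs.map (! ·)) QK Q1 Q2).2 + 1 = d then
        F 1 (sideGet3 S bs PK P1 P2).1 (sideGet3 S (bs.map (! ·)) QK Q1 Q2).1 else 0)

/-- With a correct side table, `FK.coefSide3` IS `FK.coefTab3`. [folklore] -/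
theorem coefTab3_eq_coefSide3 {L : List (ι × ι)} {iK jK kK i1 j1 k1 i2 j2 k2 ix iy is : ι}
    {S : List (List (List (List (Pat3 × ℕ))))} (h : sideCheck3 L iK jK kK i1 j1 k1 i2 j2 k2 ix iy is S = true)
    (F : ℕ → Pat3 → Pat3 → ℤ) (d : ℕ) (PK QK P1 Q1 P2 Q2 : Pat3) :
    coefTab3 L iK jK kK i1 j1 k1 i2 j2 k2 ix iy is F d PK QK P1 Q1 P2 Q2 = coefSide3 L.length S F d PK QK P1 Q1 P2 Q2 := by
  unfold coefTab3 coefSide3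
  refine sumBits_congr_len L.length fun bs hbs => ?_
  have hbs' : (bs.map (! ·)).length = L.length := by rw [List.length_map, hbs]
  have e1 := sideCheck3_spec h hbs PK P1 P2
  have e2 := sideCheck3_spec h hbs' QK Q1 Q2
  unfold side3R at e1 e2
  rw [e1, e2]

/-- Lookup in a three-piece coefficient literal `[d][PK][QK][P1][Q1][P2][Q2]` (missing tails read `0`, so the literal may be
sparse: trailing zero blocks dropped). [folklore] -/
def coefGet3 (T : List (List (List (List (List (List (List ℤ))))))) (d : ℕ) (PK QK P1 Q1 P2 Q2 : Pat3) : ℤ :=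
  ((((((T.getD d []).getD PK.ix []).getD QK.ix []).getD P1.ix []).getD Q1.ix []).getD P2.ix []).getD Q2.ix 0

/-- The rows of the coefficient-table check at one level `d`. [folklore] -/
def coefRows3 (n : ℕ) (S : List (List (List (List (Pat3 × ℕ))))) (F : ℕ → Pat3 → Pat3 → ℤ)
    (T : List (List (List (List (List (List (List ℤ))))))) (d : ℕ) : Bool :=
  Pat3.list.all fun PK => Pat3.list.all fun QK => Pat3.list.all fun P1 => Pat3.list.all fun Q1 => Pat3.list.all fun P2 =>
    Pat3.list.all fun Q2 => decide (coefGet3 T d PK QK P1 Q1 P2 Q2 = coefSide3 n S F d PK QK P1 Q1 P2 Q2)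

/-- **Coefficient-table check** (three pieces): the literal IS the coefficient table at all levels `d < nd`. [folklore] -/
def coefCheck3 (n : ℕ) (S : List (List (List (List (Pat3 × ℕ))))) (F : ℕ → Pat3 → Pat3 → ℤ)
    (T : List (List (List (List (List (List (List ℤ))))))) (nd : ℕ) : Bool :=
  (List.range nd).all (coefRows3 n S F T)

/-- Assembling the coefficient-table check from its levels. [folklore] -/
theorem coefCheck3_of_levels {n : ℕ} {S : List (List (List (List (Pat3 × ℕ))))} {F : ℕ → Pat3 → Pat3 → ℤ}
    {T : List (List (List (List (List (List (List ℤ))))))} {nd : ℕ} (h : ∀ d, d < nd → coefRows3 n S F T d = true) :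
    coefCheck3 n S F T nd = true := by
  unfold coefCheck3
  rw [List.all_eq_true]
  exact fun d hd => h d (List.mem_range.1 hd)

/-- Unpacking a passed three-piece coefficient-table check. [folklore] -/
theorem coefCheck3_spec {n : ℕ} {S : List (List (List (List (Pat3 × ℕ))))} {F : ℕ → Pat3 → Pat3 → ℤ}
    {T : List (List (List (List (List (List (List ℤ))))))} {nd : ℕ} (h : coefCheck3 n S F T nd = true) {d : ℕ} (hd : d < nd)
    (PK QK P1 Q1 P2 Q2 : Pat3) : coefGet3 T d PK QK P1 Q1 P2 Q2 = coefSide3 n S F d PK QK P1 Q1 P2 Q2 := by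
  unfold coefCheck3 at h
  simp only [List.all_eq_true] at h
  have h1 := h d (List.mem_range.2 hd)
  unfold coefRows3 at h1
  simp only [List.all_eq_true, decide_eq_true_eq] at h1
  exact h1 PK PK.mem_list QK QK.mem_list P1 P1.mem_list Q1 Q1.mem_list P2 P2.mem_list Q2 Q2.mem_list

/-- Beyond the literal's length the lookup reads `0`. [folklore] -/
theorem coefGet3_eq_zero {T : List (List (List (List (List (List (List ℤ))))))} {d : ℕ} (hd : T.length ≤ d)
    (PK QK P1 Q1 P2 Q2 : Pat3) : coefGet3 T d PK QK P1 Q1 P2 Q2 = 0 := by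
  unfold coefGet3
  have e : T.getD d [] = [] := by rw [List.getD_eq_getElem?_getD, List.getElem?_eq_none hd, Option.getD_none]
  rw [e]
  rfl

/-- **Rows from the tabulated + filtered checks** (three pieces): side table, coefficient table up to `B + 6` (literal of
length `≤ B + 6`), shift bound, and census g36's 25 first-pair loops `FK.loop1G` against the SYMMETRISED coefficient lookup
(`m = 8`) give the rowwise domination consumed by `FK.shape3C_nonneg_of_rows`. [folklore] -/
theorem rows_of_tab3 {L : List (ι × ι)} {iK jK kK i1 j1 k1 i2 j2 k2 ix iy is : ι} {F : ℕ → Pat3 → Pat3 → ℤ}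
    {S : List (List (List (List (Pat3 × ℕ))))} {T : List (List (List (List (List (List (List ℤ))))))} {prods : List Prod3}
    {Dn B : ℕ} (hB : 2 * L.length + 2 ≤ B) (hS : sideCheck3 L iK jK kK i1 j1 k1 i2 j2 k2 ix iy is S = true)
    (hT : coefCheck3 L.length S F T (B + 6) = true) (hlen : T.length ≤ B + 6)
    (hshift : (prods.all fun p => decide (p.shift ≤ B)) = true)
    (hpairs : ∀ PK QK : Pat3, loop1G (symm8d (coefGet3 T)) 8 Dn B (prods.filter fun p => suppAt p.gK PK QK) PK QK = true)
    (d : ℕ) (PK QK P1 Q1 P2 Q2 : Pat3) :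
    8 * (prods.map fun q => (q.lam : ℤ) * q.tensor d PK QK P1 Q1 P2 Q2).sum ≤
      (Dn : ℤ) * symm8d (coefTab3 L iK jK kK i1 j1 k1 i2 j2 k2 ix iy is F) d PK QK P1 Q1 P2 Q2 := by
  have hz : ∀ d', B + 6 ≤ d' → ∀ A1 A2 A3 A4 A5 A6 : Pat3, coefGet3 T d' A1 A2 A3 A4 A5 A6 = 0 :=
    fun d' hd' _ _ _ _ _ _ => coefGet3_eq_zero (hlen.trans hd') _ _ _ _ _ _
  have key := certCheckG_of_pairs 8 Dn B hshift hpairs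
    (fun d' hd' A1 A2 A3 A4 A5 A6 => by simp only [symm8d, hz d' hd', add_zero, le_refl]) d PK QK P1 Q1 P2 Q2
  have e : symm8d (coefTab3 L iK jK kK i1 j1 k1 i2 j2 k2 ix iy is F) d PK QK P1 Q1 P2 Q2 = symm8d (coefGet3 T) d PK QK P1 Q1 P2 Q2 := by
    by_cases hd : d < B + 6
    · simp only [symm8d, coefTab3_eq_coefSide3 hS, coefCheck3_spec hT hd]
    · rw [not_lt] at hd
      have hz' : ∀ A1 A2 A3 A4 A5 A6 : Pat3, coefTab3 L iK jK kK i1 j1 k1 i2 j2 k2 ix iy is F d A1 A2 A3 A4 A5 A6 = 0 :=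
        fun _ _ _ _ _ _ => coefTab3_eq_zero L iK jK kK i1 j1 k1 i2 j2 k2 ix iy is F (by omega) _ _ _ _ _ _
      simp only [symm8d, hz', hz d hd, add_zero]
  rw [e]
  exact_mod_cast key

end TabThree

/-! ### Cell-wise (all levels in ONE pass over the colourings) verification of a three-piece coefficient literal (census g40), on
the generic fold `FK.foldVec` of `…Pat3ShapeTwoCells.lean`; units per first pattern `PK` (`FK.coefCells3`) or per first pair
`(PK, QK)` (`FK.coefCellsPQ3`, for skeletons with many colourings) -/

section CoefCell

/-- The two-level contributions of the colourings at one three-piece cell. [folklore] -/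
def cellTerms3 (n : ℕ) (S : List (List (List (List (Pat3 × ℕ))))) (F : ℕ → Pat3 → Pat3 → ℤ) (PK QK P1 Q1 P2 Q2 : Pat3) :
    List (ℕ × ℤ × ℤ) :=
  (allBits n).map fun bs =>
    ((sideGet3 S bs PK P1 P2).2 + (sideGet3 S (bs.map (! ·)) QK Q1 Q2).2,
      F 0 (sideGet3 S bs PK P1 P2).1 (sideGet3 S (bs.map (! ·)) QK Q1 Q2).1,
      F 1 (sideGet3 S bs PK P1 P2).1 (sideGet3 S (bs.map (! ·)) QK Q1 Q2).1)

/-- The three-piece literal's column at one cell, levels `d < nd`. [folklore] -/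
def cellLit3 (T : List (List (List (List (List (List (List ℤ))))))) (nd : ℕ) (PK QK P1 Q1 P2 Q2 : Pat3) : List ℤ :=
  (List.range nd).map fun d => coefGet3 T d PK QK P1 Q1 P2 Q2

/-- One cell passes: level indices in range and the literal's column equals the folded vector. [folklore] -/
def cellOK3 (nd n : ℕ) (S : List (List (List (List (Pat3 × ℕ))))) (F : ℕ → Pat3 → Pat3 → ℤ)
    (T : List (List (List (List (List (List (List ℤ))))))) (PK QK P1 Q1 P2 Q2 : Pat3) : Bool :=
  ((cellTerms3 n S F PK QK P1 Q1 P2 Q2).all fun t => decide (t.1 + 1 < nd)) &&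
    decide (cellLit3 T nd PK QK P1 Q1 P2 Q2 = foldVec nd (cellTerms3 n S F PK QK P1 Q1 P2 Q2))

/-- A passed cell gives the literal at every level below `nd`. [folklore] -/
theorem cellOK3_spec {nd n : ℕ} {S : List (List (List (List (Pat3 × ℕ))))} {F : ℕ → Pat3 → Pat3 → ℤ}
    {T : List (List (List (List (List (List (List ℤ))))))} {PK QK P1 Q1 P2 Q2 : Pat3}
    (h : cellOK3 nd n S F T PK QK P1 Q1 P2 Q2 = true) {d : ℕ} (hd : d < nd) :
    coefGet3 T d PK QK P1 Q1 P2 Q2 = coefSide3 n S F d PK QK P1 Q1 P2 Q2 := by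
  unfold cellOK3 at h
  simp only [List.all_eq_true, Bool.and_eq_true, decide_eq_true_eq] at h
  obtain ⟨hk, heq⟩ := h
  have e1 : (cellLit3 T nd PK QK P1 Q1 P2 Q2).getD d 0 = coefGet3 T d PK QK P1 Q1 P2 Q2 := by
    unfold cellLit3
    rw [List.getD_eq_getElem?_getD, List.getElem?_map, List.getElem?_range hd, Option.map_some, Option.getD_some]
  rw [← e1, heq, foldVec_getD hk hd]
  unfold coefSide3 cellTerms3
  rw [sumBits_eq_sum_allBits, List.map_map]
  rfl

/-- **Cell-wise coefficient check**, unit = first pattern `PK` (all `QK P1 Q1 P2 Q2`). [folklore] -/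
def coefCells3 (nd n : ℕ) (S : List (List (List (List (Pat3 × ℕ))))) (F : ℕ → Pat3 → Pat3 → ℤ)
    (T : List (List (List (List (List (List (List ℤ))))))) (PK : Pat3) : Bool :=
  Pat3.list.all fun QK => Pat3.list.all fun P1 => Pat3.list.all fun Q1 => Pat3.list.all fun P2 => Pat3.list.all fun Q2 =>
    cellOK3 nd n S F T PK QK P1 Q1 P2 Q2

/-- **Cell-wise coefficient check**, unit = first pair `(PK, QK)` (all `P1 Q1 P2 Q2`; for skeletons with many colourings). [folklore] -/
def coefCellsPQ3 (nd n : ℕ) (S : List (List (List (List (Pat3 × ℕ))))) (F : ℕ → Pat3 → Pat3 → ℤ)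
    (T : List (List (List (List (List (List (List ℤ))))))) (PK QK : Pat3) : Bool :=
  Pat3.list.all fun P1 => Pat3.list.all fun Q1 => Pat3.list.all fun P2 => Pat3.list.all fun Q2 => cellOK3 nd n S F T PK QK P1 Q1 P2 Q2

/-- The coefficient-table check from its five `PK` units. [folklore] -/
theorem coefCheck3_of_cells {nd n : ℕ} {S : List (List (List (List (Pat3 × ℕ))))} {F : ℕ → Pat3 → Pat3 → ℤ}
    {T : List (List (List (List (List (List (List ℤ))))))} (h : ∀ PK : Pat3, coefCells3 nd n S F T PK = true) :
    coefCheck3 n S F T nd = true := by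
  refine coefCheck3_of_levels fun d hd => ?_
  unfold coefRows3
  simp only [List.all_eq_true, decide_eq_true_eq]
  intro PK _ QK _ P1 _ Q1 _ P2 _ Q2 _
  have h1 := h PK
  unfold coefCells3 at h1
  simp only [List.all_eq_true] at h1
  exact cellOK3_spec (h1 QK QK.mem_list P1 P1.mem_list Q1 Q1.mem_list P2 P2.mem_list Q2 Q2.mem_list) hd

/-- The coefficient-table check from its twenty-five `(PK, QK)` units. [folklore] -/
theorem coefCheck3_of_cellsPQ {nd n : ℕ} {S : List (List (List (List (Pat3 × ℕ))))} {F : ℕ → Pat3 → Pat3 → ℤ}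
    {T : List (List (List (List (List (List (List ℤ))))))} (h : ∀ PK QK : Pat3, coefCellsPQ3 nd n S F T PK QK = true) :
    coefCheck3 n S F T nd = true := by
  refine coefCheck3_of_levels fun d hd => ?_
  unfold coefRows3
  simp only [List.all_eq_true, decide_eq_true_eq]
  intro PK _ QK _ P1 _ Q1 _ P2 _ Q2 _
  have h1 := h PK QK
  unfold coefCellsPQ3 at h1
  simp only [List.all_eq_true] at h1
  exact cellOK3_spec (h1 P1 P1.mem_list Q1 Q1.mem_list P2 P2.mem_list Q2 Q2.mem_list) hd

end CoefCell

end FK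

end Summit.CriticalPhenomena.PercolationContinuityZ3.Theorems
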